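import Mathlib
import Literature.MathematicalPhysics.QuantumFieldTheory.Balaban1983to89.B6Lemma21Repaired
import Literature.MathematicalPhysics.QuantumFieldTheory.Balaban1983to89.SchurTest

/-!
# `Balaban1983to89.B6Ineq268` — the scale sum of (2.68), p. 235: line 4 ⇒ line 5 holds with an O(1) independent of
the number of scales k if and only if 8 log L ≤ δ₀RM (sufficiency over any multiscale geometry from Lemma-2.1-type
input; necessity by a chain witness); the route literally citing «(2.60), (2.63)» needs 12 log L ≤ δ₀RM; the «purely
conventional» interchange of the powers costs L^{d+4} and a fraction of the rate — and is free for the self-adjoint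
Q′G′²Q′*; Q′G′²Q′* is bounded on L²(𝔅) from (2.61) alone, as printed (B6 = T. Bałaban, *Propagators and
renormalization transformations for lattice gauge theories. II*, Commun. Math. Phys. **96**, 223–250 (1984)
[Balaban1984PropagatorsII])

CITATION HEADER (lean-in-tree rule 2026-08-18).  Cell `pub-balaban`, unit `b2b-balaban-b06-g5` (paper sub-cell B06,
gen 5 — the owner lineage of `…B6`, `…B6RandomWalk`, `…B6KernelComposition`, `…B6WeightedEncoding`).  Source:
doi:10.1007/bf01240221, held `paper:balaban1984-cmp96-propagators-rt-ii`; journal page = PDF page + 222; the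
quotations below were read from the page renders `b2b-balaban-ref1/pages/1984-cmp96-propagators-rt-II/
1984-cmp96-propagators-rt-II-p012-x2.png` (p. 234), `…-p013-x2.png` (p. 235) and `…-p015-x2.png` (p. 237) AS IMAGES.
Answers the adversarial row GAPS G-adv9-37 (unit b2b-balaban-adv9-g14) against the owner's census C-B6-3; cell rows
GAPS C-b06g5-2, DIVERGENCE D-b06.16; journal claim G-adv9-37-KERNEL.  v1.1 (DOCFIX, cross-read REFEREE6.md E55 /
GAPS C-ref6-55): the two p. 235 sentences quoted in the docstrings of `power_swap` and `applyW_selfAdjoint_iff` made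
verbatim; no declaration changed.

THE PRINTED TEXT.  p. 235 [PDF 13], (2.68), members 3–6, verbatim (y ∈ Λ_j, y′ ∈ Λ_{j′}, y″ ∈ Λ_{j″}; 𝔅 = ⋃_j Λ_j):
*"≤ Σ_{y″∈𝔅} O(1)(L^jη)² e^{−½δ₀d(y,y″)} (L^{j″}η)² (L^{j′}η)^{−d} e^{−½δ₀d(y″,y′)}
≤ O(1)(L^jη)⁴(L^{j′}η)^{−d} Σ_{y″∈𝔅} e^{−⅙δ₀d(y,y″)} L^{2(j″−j)} e^{−⅓δ₀d(y,y″)} e^{−⅓δ₀d(y″,y′)}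
≤ O(1)(L^jη)⁴(L^{j′}η)^{−d} Σ_{y″∈𝔅} e^{−⅙δ₀RM max{|j″−j|−1,0}} L^{2(j″−j)} · e^{−⅓δ₀d(y,y″)} e^{−⅓δ₀d(y″,y′)}
≤ O(1)(L^jη)⁴(L^{j′}η)^{−d} e^{−¼δ₀d(y,y′)}, (2.68) where we have used the inequalities (2.60), (2.63) of Lemma 1.
Let us notice that the choice of powers (L^jη)⁴ and (L^{j′}η)^{−d} in the inequality above is purely conventional
and we may change it into any other admissible choice, for example (L^jη)^{−d} and (L^{j′}η)⁴, using the exponential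
factor e^{−1/4δ₀d(y,y′)} and the estimate (2.60).  The inequalities (2.67), (2.68) suggest that we should consider the
operator Q′G′²Q′* on a Hilbert space L²(𝔅) defined by the scalar product ⟨λ, λ′⟩ = Σ_{j=0}^k Σ_{y∈Λ_j}
(L^jη)^d λ(y)λ′(y). (2.69) It is easy to see from the bound (2.58) that Q′G′²Q′* is a bounded operator on this space;
we have to use only the bound (2.61).  Now we will consider the operator (Q′G′²Q′*)^{−1}. Of course the operator
Q′G′²Q′* is positive definite, so its inverse is well defined."*  Lemma 2.1, p. 234 [PDF 12], verbatim: *"For the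
numbers α, 0 < α < 1, c₁(α) = 12c₀^d(½α), and RM satisfying (2.59) we have e^{−αδ₀d(y,y′)} ≤
e^{−αδ₀RM max{|j−j′|−1,0}}, y ∈ Λ_j, y′ ∈ Λ_{j′}, (2.60) sup_{y∈𝔅} Σ_{y′∈𝔅} e^{−αδ₀d(y,y′)} ≤ c₁(α), (2.61) hence …
and Σ_{y₁,…,y_{n−1}∈𝔅} e^{−δ₀d(y,y₁)}·…·e^{−δ₀d(y_{n−1},y′)} ≤ c₁(α)ⁿ e^{−(1−α)δ₀d(y,y′)}. (2.63)"* (tree: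
`B6RandomWalk.Ineq260/Ineq261/Ineq263`, generic-constant forms `B6Lemma21Repaired.Ineq261With/Ineq263With`; the
triangle inequality (2.54), p. 233, = `B6RandomWalk.Triangle254`).  The weighted-kernel convention of 𝔅, (2.83) line 1,
p. 237 [PDF 15]: *"Σ_{y″∈supp h_{□′}} (L^{j′}η)^d (Q′G′²Q′*)(y, y″) h_{□′}(y″) C_{□′}(y″, y′) h_{□′}(y′)"*.

THE QUESTION (GAPS G-adv9-37 (a)–(c)).  In line 4 ⇒ line 5 the weight L^{2(j″−j)} is unbounded in j″ − j ≤ k, and the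
only decay in the level difference that Lemma 2.1 offers is (2.60).  Under which relation between L and δ₀RM is the
O(1) of line 5 independent of the number of scales, given ONLY what the proof cites ((2.54), (2.60), (2.61)/(2.63))?
The print states none at this point; (2.59) constrains RM through d, δ₀, c₀ only (*"a condition written in terms of
absolute constants δ₀, c₀"*, p. 234).  And: what does the interchange of the powers cost, and does the boundedness of
Q′G′²Q′* on L²(𝔅) need it?

WHAT THIS MODULE PROVES (kernel-checked; no `sorry`, no axiom beyond Lean's three; every hypothesis is a tree
definition applied to the abstract carrier `g : B6.Geometry` of `…B6` — 𝔅 = `g.Site`, j = `g.scale`, d = `g.dist`,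
L^jη = `g.len`, L, R, M — so nothing about the operators G′, Q′ is asserted):
* §1–2  `line2` … `line5` = members 3–6 of (2.68) with the common prefactor O(1)(L^jη)⁴(L^{j′}η)^{−d} removed
  ((L^{j″}η)² = (L^jη)²L^{2(j″−j)}, `len_sq_eq`); `LevelSep` = the metric content RM·max{|j−j′|−1,0} ≤ d(y,y′) of
  (2.60) (`levelSep_iff_ineq260`); the two printed intermediate steps `line2_le_line3` (½ = ⅙ + ⅓) and
  `line3_le_line4` ((2.60) at the rate ⅙δ₀).
* §3  SUFFICIENCY, SHARP FORM.  `line4_le_line5`: (2.54) + symmetry of d + (2.60) + (2.61) at α = 1/12 with constant c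
  + L ≥ 1, RM ≥ 0, δ₀ ≥ 0 + **L² ≤ e^{¼δ₀RM} (8 log L ≤ δ₀RM)** ⇒ line 4 ≤ L²·c·line 5 for all y, y′, uniformly
  in k.  Mechanism (`scaleSum_le`, `ratio_mul_exp_le`): of the rate ⅓ on d(y,y″), ¼ goes to the output through (2.54)
  and the residue 1/12, through (2.60), JOINS the level factor — e^{−(⅙+1/12)δ₀RM·max{…}} = e^{−¼δ₀RM·max{…}} absorbs
  L^{2(j″−j)} = L²(L²)^{max{…}} exactly when L² ≤ e^{¼δ₀RM}; of the rate ⅓ on d(y″,y′), ¼ goes to the output and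
  1/12 pays the y″-sum by (2.61).  `line4_le_line5_literal`: the reading that spends nothing of d(y,y″) on the levels
  — the weight is bounded by its supremum (L^{2(n+1)}e^{−⅙δ₀RMn} ≤ L² for all n iff **12 log L ≤ δ₀RM**) and the two
  factors e^{−⅓δ₀d} are summed by (2.63) of Lemma 1 with δ₀ ← ⅓δ₀, n = 2, α = ¼ (constant c²; that instance of
  (2.63) is again (2.61) at the rate δ₀/12, `B6Lemma21Repaired.ineq263With_of_261With`) — the route and the threshold
  of G-adv9-37 (a).  `line2_le_line5`: from line 2 directly, the same bound L²·c·line 5 under the same 8 log L ≤ δ₀RM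
  needs (2.61) at α = ¼ only: it is the printed splitting ½ = ⅙ + ⅓ of lines 3–4, not the estimate, that forces
  Lemma 2.1 at α = 1/12 (hence (2.59) at α = 1/12, G-adv9-37 (c)) on the routes from line 4.
* §4  NECESSITY.  `chainGeo k` = the chain witness (one site on each level 0, …, k, d(i,i′) = RM·|i − i′| — the
  spacing (2.57) allows), satisfying (2.54), symmetry, (2.60) (`chainGeo_triangle/symm/levelSep`) and (2.61) at
  every rate α with the k-INDEPENDENT constant c₀(αδ₀RM) of p. 233 (`chainGeo_ineq261With`, by the tree's
  `B6Lemma21Arith.summable_c0_term`).  `line4_not_uniform` / `line2_not_uniform`: if L² > e^{¼δ₀RM} then for every C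
  some depth k and pair y, y′ give line 4 > C·line 5 (resp. line 2 > C·line 5) — the diagonal term y″ = y′ at the top
  level is L^{2k}e^{−½δ₀RMk} against e^{−¼δ₀RMk}.  Hence 8 log L ≤ δ₀RM is the EXACT condition for a k-uniform O(1)
  in (2.68) line 5 from Lemma-2.1-type input, by any route.
* §5  THE SWAP.  `power_swap`: e^{−¼δ₀d}(L^jη)⁴(L^{j′}η)^{−d} ≤ L^{d+4}·e^{−(¼−ε)δ₀d}·(L^{j′}η)⁴(L^jη)^{−d} whenever
  L^{d+4} ≤ e^{εδ₀RM} ((d+4) log L ≤ εδ₀RM), εδ₀ ≥ 0, from the metric (2.60) — the sentence *"purely conventional …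
  using the exponential factor e^{−1/4δ₀d(y,y′)} and the estimate (2.60)"* made quantitative (cost: the factor
  L^{d+4} and the fraction ε of the rate; G-adv9-37 (b) first half, with ε = ⅛: 8(d+4) log L ≤ δ₀RM).
  `swap_of_symm`: for a kernel SYMMETRIC in the (2.69) convention over a symmetric d — which Q′G′²Q′* is, being
  self-adjoint (*"positive definite"*) — the swapped orientation holds with the same constant and rate, no condition.
* §6  L²(𝔅).  `applyW` = the operator with a given (2.69)-kernel ((Kλ)(y) = Σ_{y′}(L^{j′}η)^d k(y,y′)λ(y′), the
  convention of (2.83) line 1); `applyW_selfAdjoint_iff`: self-adjoint for (2.69) ⇔ symmetric kernel;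
  `weighted_schur(_symm)`: the weighted Schur test, from the tree's `SchurTest.row_sq_le`; `bounded_of_ineq268`: a
  symmetric kernel obeying (2.68), |k(y,y′)| ≤ C(L^jη)⁴(L^{j′}η)^{−d}e^{−¼δ₀d(y,y′)}, with 0 < L^jη ≤ 1, has
  (2.69)-weighted row sums ≤ C·c by (2.61) at α = ¼ — the weight (L^{j′}η)^d cancels (L^{j′}η)^{−d} exactly and
  (L^jη)⁴ ≤ 1 — hence Σ_y (L^jη)^d (Kλ)(y)² ≤ (C·c)² Σ_y (L^jη)^d λ(y)², i.e. ‖Q′G′²Q′*‖_{L²(𝔅)} ≤ O(1)·c₁(¼): the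
  printed *"we have to use only the bound (2.61)"* is EXACTLY RIGHT (no interchange of powers, no condition on
  log L — G-adv9-37 (b), second half, is not upheld); what it uses silently is the self-adjointness the next sentence
  provides.  ((2.58), p. 233, is the geometric sum behind (2.61); the kernel bound applied is (2.68).)

WHAT IS NOT CLAIMED.  Nothing about G′, Q′: (2.68) members 1–3 (the insertion of Σ_{y″}Δ(y″) and Proposition 2.2
twice) are the analytic input and stay with the paper (census C-B6-3 / C-adv9-39); the module certifies the scale-sum
ARITHMETIC of members 3–6 and the two sentences after it, over an abstract carrier (DIVERGENCE D-b06.16: prefactor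
removed; `LevelSep` for (2.60); symmetry of d as a hypothesis — kernel for realised geometries in
`B6Geometry.dist_comm_of_realizes`; thresholds typed as L^m ≤ e^{(…)}).  The thresholds are statements about what
follows from the CITED inequalities; the paper's standing *"R is a big positive integer which will be fixed later"*
((2.2), p. 224) leaves room for δ₀RM ≥ 8 log L, which is the located, unprinted condition at this display — of the
same kind as, and implied by, the e^{⅛δ₀RM} ≥ L⁴ (δ₀RM ≥ 32 log L) located at (2.83) line 5 (C-adv4-40) and the
RM ≳ log L of (2.88) (C-B6-3).  Relation to `…B6KernelComposition`: that module treats ONE scale (the rate loss in a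
composition of decaying kernels, witness (n+1)e^{−δn}); this one treats the sum over SCALES (the weight L^{2(j″−j)}
against the level separation (2.60)).  Value = kernel certificate of bookkeeping with its exact threshold, NOT
summit progress.
-/

namespace Literature.MathematicalPhysics.QuantumFieldTheory.Balaban1983to89.B6Ineq268

open Literature.MathematicalPhysics.QuantumFieldTheory.Balaban1983to89
open Finset

/-! ## §1. Carriers: the level factor, the scale ratio, the metric content of (2.60), lines 2–5 of (2.68) -/

section Carriers

variable (g : B6.Geometry)

/-- max{|j − j″| − 1, 0} for y ∈ Λ_j, y″ ∈ Λ_{j″} (the exponent of (2.60), in the orientation of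
`B6RandomWalk.Ineq260`; = the printed max{|j″ − j| − 1, 0} of (2.68) line 4 by `mx_comm`).
[cite: Balaban1984PropagatorsII, (2.60) p.234 + (2.68) p.235] -/
noncomputable def mx (y y'' : g.Site) : ℝ := max (|(g.scale y : ℝ) - g.scale y''| - 1) 0

/-- The scale ratio L^{2(j″−j)} of (2.68) lines 3–4 (y ∈ Λ_j, y″ ∈ Λ_{j″}), typed as L^{2j″}/L^{2j} (natural-number
exponents; no integer powers). [cite: Balaban1984PropagatorsII, (2.68) p.235] -/
noncomputable def ratio (y y'' : g.Site) : ℝ := g.L ^ (2 * g.scale y'') / g.L ^ (2 * g.scale y)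

/-- The METRIC CONTENT of (2.60): RM·max{|j − j′| − 1, 0} ≤ d(y, y′) (equivalent to `B6RandomWalk.Ineq260 g δ₀ α` for
every αδ₀ > 0, `levelSep_iff_ineq260`; it is (2.57)–(2.58)'s "each crossing of an intermediate scale layer costs ≥ RM",
kernel-derived from (2.2) in `B6Geometry.ineq260_of_levelGap`). [cite: Balaban1984PropagatorsII, (2.60) p.234] -/
def LevelSep (g : B6.Geometry) : Prop := ∀ y y' : g.Site, g.R * g.M * mx g y y' ≤ g.dist y y'

/-- Symmetry d(y, y′) = d(y′, y) of the multiscale distance (2.46) (contours reversed; kernel for realised geometries: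
`B6Geometry.dist_comm_of_realizes`) — a hypothesis on the abstract carrier. [cite: Balaban1984PropagatorsII, (2.46) p.231] -/
def Symm (g : B6.Geometry) : Prop := ∀ y y' : g.Site, g.dist y y' = g.dist y' y

/-- (2.68) LINE 2 with the prefactor O(1)(L^jη)⁴(L^{j′}η)^{−d} taken out, verbatim otherwise:
Σ_{y″∈𝔅} L^{2(j″−j)} e^{−½δ₀d(y,y″)} e^{−½δ₀d(y″,y′)} — printed as
*"Σ_{y″∈𝔅} O(1)(L^jη)² e^{−½δ₀d(y,y″)} (L^{j″}η)² (L^{j′}η)^{−d} e^{−½δ₀d(y″,y′)}"* and (L^{j″}η)² = (L^jη)² L^{2(j″−j)}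
(`len_sq_eq`). [cite: Balaban1984PropagatorsII, (2.68) line 2 p.235] -/
noncomputable def line2 (δ₀ : ℝ) (y y' : g.Site) : ℝ :=
  ∑ y'' : g.Site, ratio g y y'' * Real.exp (-(1 / 2 * δ₀ * g.dist y y'')) * Real.exp (-(1 / 2 * δ₀ * g.dist y'' y'))

/-- (2.68) LINE 3 (prefactor O(1)(L^jη)⁴(L^{j′}η)^{−d} taken out), verbatim:
*"Σ_{y″∈𝔅} e^{−⅙δ₀d(y,y″)} L^{2(j″−j)} e^{−⅓δ₀d(y,y″)} e^{−⅓δ₀d(y″,y′)}"*. [cite: Balaban1984PropagatorsII, (2.68) line 3 p.235] -/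
noncomputable def line3 (δ₀ : ℝ) (y y' : g.Site) : ℝ :=
  ∑ y'' : g.Site, Real.exp (-(1 / 6 * δ₀ * g.dist y y'')) * ratio g y y'' *
    Real.exp (-(1 / 3 * δ₀ * g.dist y y'')) * Real.exp (-(1 / 3 * δ₀ * g.dist y'' y'))

/-- (2.68) LINE 4 (prefactor taken out), verbatim:
*"Σ_{y″∈𝔅} e^{−⅙δ₀RM max{|j″−j|−1,0}} L^{2(j″−j)} · e^{−⅓δ₀d(y,y″)} e^{−⅓δ₀d(y″,y′)}"*.
[cite: Balaban1984PropagatorsII, (2.68) line 4 p.235] -/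
noncomputable def line4 (δ₀ : ℝ) (y y' : g.Site) : ℝ :=
  ∑ y'' : g.Site, Real.exp (-(1 / 6 * δ₀ * g.R * g.M * mx g y y'')) * ratio g y y'' *
    Real.exp (-(1 / 3 * δ₀ * g.dist y y'')) * Real.exp (-(1 / 3 * δ₀ * g.dist y'' y'))

/-- (2.68) LINE 5 (prefactor taken out): *"e^{−¼δ₀d(y,y′)}"*. [cite: Balaban1984PropagatorsII, (2.68) line 5 p.235] -/
noncomputable def line5 (δ₀ : ℝ) (y y' : g.Site) : ℝ := Real.exp (-(1 / 4 * δ₀ * g.dist y y'))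

variable {g}

/-- The level exponent is non-negative. [folklore] -/
theorem mx_nonneg (y y'' : g.Site) : 0 ≤ mx g y y'' := le_max_right _ _

/-- The level exponent is symmetric in the two levels (printed orientation of (2.68) line 4). [folklore] -/
theorem mx_comm (y y'' : g.Site) : mx g y y'' = max (|(g.scale y'' : ℝ) - g.scale y| - 1) 0 := by
  unfold mx; rw [abs_sub_comm]

/-- For j″ ≤ j nothing is claimed beyond `mx ≥ 0`; for j″ = j + 1 + n the level exponent is exactly n. [folklore] -/
theorem mx_eq_of_lt {y y'' : g.Site} {n : ℕ} (h : g.scale y'' = g.scale y + 1 + n) : mx g y y'' = n := by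
  unfold mx
  rw [h]
  push_cast
  rw [show ((g.scale y : ℝ) - (g.scale y + 1 + n)) = -((n : ℝ) + 1) by ring, abs_neg,
    abs_of_nonneg (by positivity)]
  simp

/-- The level exponent for j = j″ + 1 + n is exactly n. [folklore] -/
theorem mx_eq_of_lt' {y y'' : g.Site} {n : ℕ} (h : g.scale y = g.scale y'' + 1 + n) : mx g y y'' = n := by
  unfold mx
  rw [h]
  push_cast
  rw [show (((g.scale y'' : ℝ) + 1 + n) - g.scale y'') = (n : ℝ) + 1 by ring, abs_of_nonneg (by positivity)]
  simp

/-- (2.60) at a rate αδ₀ > 0 IS the metric statement `LevelSep` (exp is strictly monotone). [folklore] -/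
theorem levelSep_iff_ineq260 {δ₀ α : ℝ} (hαδ : 0 < α * δ₀) : LevelSep g ↔ B6RandomWalk.Ineq260 g δ₀ α := by
  constructor
  · intro h y y'
    have := h y y'
    rw [Real.exp_le_exp]
    unfold mx at this
    nlinarith
  · intro h y y'
    have := (Real.exp_le_exp).1 (h y y')
    unfold mx
    nlinarith

/-- (2.60) at every rate αδ₀ ≥ 0 from `LevelSep`. [folklore] -/
theorem ineq260_of_levelSep (h : LevelSep g) {δ₀ α : ℝ} (hαδ : 0 ≤ α * δ₀) : B6RandomWalk.Ineq260 g δ₀ α := by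
  intro y y'
  have := h y y'
  rw [Real.exp_le_exp]
  unfold mx at this
  nlinarith

/-- `LevelSep` with RM ≥ 0 makes the distance non-negative. [folklore] -/
theorem dist_nonneg_of_levelSep (h : LevelSep g) (hRM : 0 ≤ g.R * g.M) (y y' : g.Site) : 0 ≤ g.dist y y' :=
  le_trans (mul_nonneg hRM (mx_nonneg y y')) (h y y')

/-- Line 2 → line 3 bookkeeping: (L^{j″}η)² = (L^jη)² · L^{2(j″−j)}, i.e. (L^{j″}η)²/(L^jη)² = `ratio`. [folklore] -/
theorem len_sq_eq (hL : g.L ≠ 0) (hη : g.eta ≠ 0) (y y'' : g.Site) :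
    g.len y'' ^ 2 = g.len y ^ 2 * ratio g y y'' := by
  unfold B6.Geometry.len ratio
  have h1 : g.L ^ (2 * g.scale y) ≠ 0 := pow_ne_zero _ hL
  field_simp
  ring

/-- The scale ratio is non-negative for L ≥ 0. [folklore] -/
theorem ratio_nonneg (hL : 0 ≤ g.L) (y y'' : g.Site) : 0 ≤ ratio g y y'' := by
  unfold ratio; positivity

end Carriers

/-! ## §2. The printed chain line 2 ≤ line 3 ≤ line 4 (bookkeeping; (2.60) at the rate ⅙δ₀) -/

section PrintedChain

variable {g : B6.Geometry}

/-- line 2 ≤ line 3: ½ = ⅙ + ⅓ on d(y,y″) (an identity) and e^{−½δ₀d(y″,y′)} ≤ e^{−⅓δ₀d(y″,y′)} (needs δ₀d ≥ 0).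
[cite: Balaban1984PropagatorsII, (2.68) p.235] -/
theorem line2_le_line3 (hL : 0 ≤ g.L) {δ₀ : ℝ} (hδ : 0 ≤ δ₀) (hd : ∀ a b : g.Site, 0 ≤ g.dist a b) (y y' : g.Site) :
    line2 g δ₀ y y' ≤ line3 g δ₀ y y' := by
  unfold line2 line3
  refine Finset.sum_le_sum fun y'' _ => ?_
  have hsplit : Real.exp (-(1 / 6 * δ₀ * g.dist y y'')) * ratio g y y'' * Real.exp (-(1 / 3 * δ₀ * g.dist y y'')) =
      ratio g y y'' * Real.exp (-(1 / 2 * δ₀ * g.dist y y'')) := by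
    rw [mul_comm (Real.exp _) (ratio g y y''), mul_assoc, ← Real.exp_add]
    congr 2; ring
  rw [hsplit]
  refine mul_le_mul_of_nonneg_left ?_ (mul_nonneg (ratio_nonneg hL y y'') (Real.exp_nonneg _))
  rw [Real.exp_le_exp]
  have := hd y'' y'
  nlinarith

/-- line 3 ≤ line 4: (2.60) at the rate ⅙δ₀, i.e. `LevelSep` (with δ₀ ≥ 0). [cite: Balaban1984PropagatorsII, (2.68) p.235 «(2.60)»] -/
theorem line3_le_line4 (hsep : LevelSep g) (hL : 0 ≤ g.L) {δ₀ : ℝ} (hδ : 0 ≤ δ₀) (y y' : g.Site) :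
    line3 g δ₀ y y' ≤ line4 g δ₀ y y' := by
  unfold line3 line4
  refine Finset.sum_le_sum fun y'' _ => ?_
  have h260 : Real.exp (-(1 / 6 * δ₀ * g.dist y y'')) ≤ Real.exp (-(1 / 6 * δ₀ * g.R * g.M * mx g y y'')) := by
    rw [Real.exp_le_exp]
    have := hsep y y''
    nlinarith
  have hnn : 0 ≤ ratio g y y'' * Real.exp (-(1 / 3 * δ₀ * g.dist y y'')) * Real.exp (-(1 / 3 * δ₀ * g.dist y'' y')) :=
    mul_nonneg (mul_nonneg (ratio_nonneg hL y y'') (Real.exp_nonneg _)) (Real.exp_nonneg _)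
  calc Real.exp (-(1 / 6 * δ₀ * g.dist y y'')) * ratio g y y'' * Real.exp (-(1 / 3 * δ₀ * g.dist y y'')) *
        Real.exp (-(1 / 3 * δ₀ * g.dist y'' y'))
      = Real.exp (-(1 / 6 * δ₀ * g.dist y y'')) *
          (ratio g y y'' * Real.exp (-(1 / 3 * δ₀ * g.dist y y'')) * Real.exp (-(1 / 3 * δ₀ * g.dist y'' y'))) := by ring
    _ ≤ Real.exp (-(1 / 6 * δ₀ * g.R * g.M * mx g y y'')) *
          (ratio g y y'' * Real.exp (-(1 / 3 * δ₀ * g.dist y y'')) * Real.exp (-(1 / 3 * δ₀ * g.dist y'' y'))) :=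
        mul_le_mul_of_nonneg_right h260 hnn
    _ = _ := by ring

end PrintedChain

/-! ## §3. Line 4 ⇒ line 5: the k-uniform bound and its threshold -/

section Engine

variable {g : B6.Geometry}

/-- THE WEIGHT ABSORPTION.  If L ≥ 1, β ≥ 0 and L² ≤ e^{β}, then L^{2(j″−j)} e^{−β max{|j−j″|−1,0}} ≤ L² for all levels
j, j″ (for j″ ≤ j both factors are ≤ 1; for j″ = j + 1 + n it reads L²(L²e^{−β})ⁿ ≤ L²). [folklore] -/
theorem ratio_mul_exp_le (hL : 1 ≤ g.L) {β : ℝ} (hβ : 0 ≤ β) (hthr : g.L ^ 2 ≤ Real.exp β) (y y'' : g.Site) :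
    ratio g y y'' * Real.exp (-(β * mx g y y'')) ≤ g.L ^ 2 := by
  have hL0 : 0 < g.L := lt_of_lt_of_le one_pos hL
  have hLsq : 1 ≤ g.L ^ 2 := one_le_pow₀ hL
  rcases le_or_gt (g.scale y'') (g.scale y) with hle | hlt
  · -- j″ ≤ j : ratio ≤ 1 and the exponential factor ≤ 1
    have hr : ratio g y y'' ≤ 1 := by
      unfold ratio
      rw [div_le_one (pow_pos hL0 _)]
      exact pow_le_pow_right₀ hL (by omega)
    have he : Real.exp (-(β * mx g y y'')) ≤ 1 := by
      rw [Real.exp_le_one_iff]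
      have := mx_nonneg y y''
      nlinarith
    calc ratio g y y'' * Real.exp (-(β * mx g y y'')) ≤ 1 * 1 :=
          mul_le_mul hr he (Real.exp_nonneg _) zero_le_one
      _ ≤ g.L ^ 2 := by rw [one_mul]; exact hLsq
  · -- j″ = j + 1 + n
    obtain ⟨n, hn⟩ := Nat.exists_eq_add_of_lt hlt
    have hn' : g.scale y'' = g.scale y + 1 + n := by omega
    have hmx : mx g y y'' = n := mx_eq_of_lt hn'
    have hr : ratio g y y'' = g.L ^ 2 * (g.L ^ 2) ^ n := by
      unfold ratio
      rw [hn', div_eq_iff (pow_ne_zero _ hL0.ne')]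
      ring
    rw [hmx, hr]
    have hpow : (g.L ^ 2) ^ n ≤ Real.exp β ^ n := pow_le_pow_left₀ (by positivity) hthr n
    have hexp : Real.exp β ^ n * Real.exp (-(β * n)) = 1 := by
      rw [← Real.exp_nat_mul, ← Real.exp_add]
      simp [mul_comm]
    calc g.L ^ 2 * (g.L ^ 2) ^ n * Real.exp (-(β * n))
        ≤ g.L ^ 2 * Real.exp β ^ n * Real.exp (-(β * n)) := by
          refine mul_le_mul_of_nonneg_right ?_ (Real.exp_nonneg _)
          exact mul_le_mul_of_nonneg_left hpow (by positivity)
      _ = g.L ^ 2 := by rw [mul_assoc, hexp, mul_one]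

/-- THE ENGINE (one proof for the two routes that use (2.61)).  A scale sum
Σ_{y″} e^{−τδ₀RM·mx(y,y″)} L^{2(j″−j)} e^{−(ρ+σ₁)δ₀d(y,y″)} e^{−(ρ+σ₂)δ₀d(y″,y′)}
is ≤ L²·c·e^{−ρδ₀d(y,y′)} as soon as the residue σ₁ of the first factor absorbs the scale ratio through (2.60)
(L² ≤ e^{(τ+σ₁)δ₀RM}) and the residue σ₂ of the second factor is summed by (2.61) at α = σ₂; the output rate ρ passes
through the triangle inequality (2.54). [folklore] -/
theorem scaleSum_le (htri : B6RandomWalk.Triangle254 g) (hsymm : Symm g) (hsep : LevelSep g) (hL : 1 ≤ g.L)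
    (hRM : 0 ≤ g.R * g.M) {δ₀ τ ρ σ₁ σ₂ c : ℝ} (hδ : 0 ≤ δ₀) (hτ : 0 ≤ τ) (hρ : 0 ≤ ρ) (hσ₁ : 0 ≤ σ₁)
    (h261 : B6Lemma21Repaired.Ineq261With c g δ₀ σ₂) (hthr : g.L ^ 2 ≤ Real.exp ((τ + σ₁) * δ₀ * g.R * g.M))
    (y y' : g.Site) :
    ∑ y'' : g.Site, Real.exp (-(τ * δ₀ * g.R * g.M * mx g y y'')) * ratio g y y'' *
        Real.exp (-((ρ + σ₁) * δ₀ * g.dist y y'')) * Real.exp (-((ρ + σ₂) * δ₀ * g.dist y'' y'))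
      ≤ g.L ^ 2 * c * Real.exp (-(ρ * δ₀ * g.dist y y')) := by
  have hL0 : 0 < g.L := lt_of_lt_of_le one_pos hL
  -- pointwise bound of the summand
  have hpt : ∀ y'' : g.Site,
      Real.exp (-(τ * δ₀ * g.R * g.M * mx g y y'')) * ratio g y y'' *
          Real.exp (-((ρ + σ₁) * δ₀ * g.dist y y'')) * Real.exp (-((ρ + σ₂) * δ₀ * g.dist y'' y'))
        ≤ g.L ^ 2 * Real.exp (-(ρ * δ₀ * g.dist y y')) * Real.exp (-(σ₂ * δ₀ * g.dist y' y'')) := by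
    intro y''
    -- (2.60) on the residue σ₁ of d(y,y″)
    have hres : Real.exp (-(σ₁ * δ₀ * g.dist y y'')) ≤ Real.exp (-(σ₁ * δ₀ * g.R * g.M * mx g y y'')) := by
      rw [Real.exp_le_exp]
      have h1 := hsep y y''
      have h2 : 0 ≤ σ₁ * δ₀ := mul_nonneg hσ₁ hδ
      nlinarith
    -- the weight absorption with β = (τ + σ₁)δ₀RM
    have hβ : 0 ≤ (τ + σ₁) * δ₀ * g.R * g.M := by
      have := mul_nonneg (mul_nonneg (add_nonneg hτ hσ₁) hδ) hRM
      linarith [mul_assoc ((τ + σ₁) * δ₀) g.R g.M]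
    have habs := ratio_mul_exp_le hL hβ hthr y y''
    -- the triangle inequality on the output rate ρ
    have htr : Real.exp (-(ρ * δ₀ * g.dist y y'')) * Real.exp (-(ρ * δ₀ * g.dist y'' y')) ≤
        Real.exp (-(ρ * δ₀ * g.dist y y')) := by
      rw [← Real.exp_add, Real.exp_le_exp]
      have h1 := htri y y'' y'
      have h2 : 0 ≤ ρ * δ₀ := mul_nonneg hρ hδ
      nlinarith
    -- symmetry on the summed residue
    have hsy : Real.exp (-((ρ + σ₂) * δ₀ * g.dist y'' y')) =
        Real.exp (-(ρ * δ₀ * g.dist y'' y')) * Real.exp (-(σ₂ * δ₀ * g.dist y' y'')) := by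
      rw [← Real.exp_add, hsymm y'' y']; congr 1; ring
    have hsp1 : Real.exp (-((ρ + σ₁) * δ₀ * g.dist y y'')) =
        Real.exp (-(ρ * δ₀ * g.dist y y'')) * Real.exp (-(σ₁ * δ₀ * g.dist y y'')) := by
      rw [← Real.exp_add]; congr 1; ring
    have hlvl : Real.exp (-(τ * δ₀ * g.R * g.M * mx g y y'')) * Real.exp (-(σ₁ * δ₀ * g.R * g.M * mx g y y'')) =
        Real.exp (-((τ + σ₁) * δ₀ * g.R * g.M * mx g y y'')) := by
      rw [← Real.exp_add]; congr 1; ring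
    rw [hsy, hsp1]
    have hr0 : 0 ≤ ratio g y y'' := ratio_nonneg hL0.le y y''
    calc Real.exp (-(τ * δ₀ * g.R * g.M * mx g y y'')) * ratio g y y'' *
          (Real.exp (-(ρ * δ₀ * g.dist y y'')) * Real.exp (-(σ₁ * δ₀ * g.dist y y''))) *
          (Real.exp (-(ρ * δ₀ * g.dist y'' y')) * Real.exp (-(σ₂ * δ₀ * g.dist y' y'')))
        = (ratio g y y'' * (Real.exp (-(τ * δ₀ * g.R * g.M * mx g y y'')) * Real.exp (-(σ₁ * δ₀ * g.dist y y'')))) *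
            (Real.exp (-(ρ * δ₀ * g.dist y y'')) * Real.exp (-(ρ * δ₀ * g.dist y'' y'))) *
            Real.exp (-(σ₂ * δ₀ * g.dist y' y'')) := by ring
      _ ≤ (ratio g y y'' * (Real.exp (-(τ * δ₀ * g.R * g.M * mx g y y'')) *
              Real.exp (-(σ₁ * δ₀ * g.R * g.M * mx g y y'')))) *
            Real.exp (-(ρ * δ₀ * g.dist y y')) * Real.exp (-(σ₂ * δ₀ * g.dist y' y'')) := by
          gcongr
      _ = (ratio g y y'' * Real.exp (-(((τ + σ₁) * δ₀ * g.R * g.M) * mx g y y''))) *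
            Real.exp (-(ρ * δ₀ * g.dist y y')) * Real.exp (-(σ₂ * δ₀ * g.dist y' y'')) := by
          rw [hlvl]
      _ ≤ g.L ^ 2 * Real.exp (-(ρ * δ₀ * g.dist y y')) * Real.exp (-(σ₂ * δ₀ * g.dist y' y'')) := by
          gcongr
  -- sum the pointwise bound and use (2.61) at α = σ₂ around y′
  calc ∑ y'' : g.Site, Real.exp (-(τ * δ₀ * g.R * g.M * mx g y y'')) * ratio g y y'' *
          Real.exp (-((ρ + σ₁) * δ₀ * g.dist y y'')) * Real.exp (-((ρ + σ₂) * δ₀ * g.dist y'' y'))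
      ≤ ∑ y'' : g.Site, g.L ^ 2 * Real.exp (-(ρ * δ₀ * g.dist y y')) * Real.exp (-(σ₂ * δ₀ * g.dist y' y'')) :=
        Finset.sum_le_sum fun y'' _ => hpt y''
    _ = g.L ^ 2 * Real.exp (-(ρ * δ₀ * g.dist y y')) * ∑ y'' : g.Site, Real.exp (-(σ₂ * δ₀ * g.dist y' y'')) := by
        rw [Finset.mul_sum]
    _ ≤ g.L ^ 2 * Real.exp (-(ρ * δ₀ * g.dist y y')) * c :=
        mul_le_mul_of_nonneg_left (h261 y') (by positivity)
    _ = g.L ^ 2 * c * Real.exp (-(ρ * δ₀ * g.dist y y')) := by ring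

/-- **LINE 4 ⇒ LINE 5, k-UNIFORM, SHARP THRESHOLD.**  Over any multiscale geometry with the triangle inequality (2.54),
a symmetric distance, the metric form of (2.60), L ≥ 1, RM ≥ 0, δ₀ ≥ 0 and (2.61) at α = 1/12 with constant c:
if 8 log L ≤ δ₀RM (typed: L² ≤ e^{¼δ₀RM}) then line 4 ≤ L²·c·line 5 for ALL y, y′ — the O(1) of line 5 is L²c,
independent of the number of scales.  Mechanism: the residue 1/12 = ⅓ − ¼ of d(y,y″), through (2.60), joins the
level factor e^{−⅙δ₀RM·mx} to e^{−¼δ₀RM·mx}, which absorbs L^{2(j″−j)}; the residue 1/12 of d(y″,y′) is summed by (2.61).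
The threshold is attained: `line4_not_uniform`. [cite: Balaban1984PropagatorsII, (2.68) p.235 «where we have used the inequalities (2.60), (2.63) of Lemma 1»] -/
theorem line4_le_line5 (htri : B6RandomWalk.Triangle254 g) (hsymm : Symm g) (hsep : LevelSep g) (hL : 1 ≤ g.L)
    (hRM : 0 ≤ g.R * g.M) {δ₀ c : ℝ} (hδ : 0 ≤ δ₀) (h261 : B6Lemma21Repaired.Ineq261With c g δ₀ (1 / 12))
    (hthr : g.L ^ 2 ≤ Real.exp (1 / 4 * δ₀ * g.R * g.M)) (y y' : g.Site) :
    line4 g δ₀ y y' ≤ g.L ^ 2 * c * line5 g δ₀ y y' := by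
  have h := scaleSum_le htri hsymm hsep hL hRM (τ := 1 / 6) (ρ := 1 / 4) (σ₁ := 1 / 12) (σ₂ := 1 / 12) hδ
    (by norm_num) (by norm_num) (by norm_num) h261 (by norm_num; simpa [mul_assoc] using hthr) y y'
  unfold line4 line5
  norm_num at h ⊢
  simpa [mul_assoc, mul_comm, mul_left_comm] using h

/-- **LINE 2 ⇒ LINE 5 DIRECTLY** (same threshold 8 log L ≤ δ₀RM, but (2.61) needed only at α = ¼, not 1/12): split each
½ as ¼ + ¼; one quarter of d(y,y″) absorbs L^{2(j″−j)} through (2.60), one quarter of d(y″,y′) is summed by (2.61), the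
two remaining quarters give line 5 by (2.54).  The printed detour through the rates ⅙/⅓ of lines 3–4 is what forces
Lemma 2.1 at α = 1/12 in `line4_le_line5`. [cite: Balaban1984PropagatorsII, (2.68) p.235] -/
theorem line2_le_line5 (htri : B6RandomWalk.Triangle254 g) (hsymm : Symm g) (hsep : LevelSep g) (hL : 1 ≤ g.L)
    (hRM : 0 ≤ g.R * g.M) {δ₀ c : ℝ} (hδ : 0 ≤ δ₀) (h261 : B6Lemma21Repaired.Ineq261With c g δ₀ (1 / 4))
    (hthr : g.L ^ 2 ≤ Real.exp (1 / 4 * δ₀ * g.R * g.M)) (y y' : g.Site) :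
    line2 g δ₀ y y' ≤ g.L ^ 2 * c * line5 g δ₀ y y' := by
  have h := scaleSum_le htri hsymm hsep hL hRM (τ := 0) (ρ := 1 / 4) (σ₁ := 1 / 4) (σ₂ := 1 / 4) hδ
    le_rfl (by norm_num) (by norm_num) h261 (by norm_num; simpa [mul_assoc] using hthr) y y'
  unfold line2 line5
  norm_num at h ⊢
  simpa [mul_assoc, mul_comm, mul_left_comm] using h

/-- `chain w 1 y y′ = Σ_z w(y,z) w(z,y′)` (the n = 2 case of (2.63)). [folklore] -/
theorem chain_one {S : Type} [Fintype S] (w : S → S → ℝ) (y y' : S) :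
    B6RandomWalk.chain w 1 y y' = ∑ z : S, w y z * w z y' := rfl

/-- **LINE 4 ⇒ LINE 5 ALONG THE PRINTED CITATION «(2.60), (2.63)»** (the reading of GAPS G-adv9-37 (a)): bound the level
factor times the scale ratio by its SUPREMUM — L^{2(n+1)}e^{−⅙δ₀RMn} ≤ L² for all n iff 12 log L ≤ δ₀RM (typed:
L² ≤ e^{⅙δ₀RM}) — and sum the two factors e^{−⅓δ₀d} by (2.63) of Lemma 2.1 applied with δ₀ ← ⅓δ₀, n = 2, α = ¼
(constant c²; that instance of (2.63) follows from (2.61) at the rate ¼·⅓δ₀ = δ₀/12, `B6Lemma21Repaired.ineq263With_of_261With`).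
On this route the threshold is 12 log L; the sharp route `line4_le_line5` spends the otherwise wasted residue and gets 8 log L.
[cite: Balaban1984PropagatorsII, (2.68) p.235 «where we have used the inequalities (2.60), (2.63) of Lemma 1»] -/
theorem line4_le_line5_literal (hL : 1 ≤ g.L) (hRM : 0 ≤ g.R * g.M) {δ₀ c : ℝ} (hδ : 0 ≤ δ₀)
    (h263 : B6Lemma21Repaired.Ineq263With c g (δ₀ / 3) (1 / 4)) (hthr : g.L ^ 2 ≤ Real.exp (1 / 6 * δ₀ * g.R * g.M))
    (y y' : g.Site) :
    line4 g δ₀ y y' ≤ g.L ^ 2 * c ^ 2 * line5 g δ₀ y y' := by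
  have hL0 : 0 < g.L := lt_of_lt_of_le one_pos hL
  have hβ : 0 ≤ 1 / 6 * δ₀ * g.R * g.M := by
    have := mul_nonneg hδ hRM; nlinarith [mul_assoc δ₀ g.R g.M]
  have hpt : ∀ y'' : g.Site,
      Real.exp (-(1 / 6 * δ₀ * g.R * g.M * mx g y y'')) * ratio g y y'' *
          Real.exp (-(1 / 3 * δ₀ * g.dist y y'')) * Real.exp (-(1 / 3 * δ₀ * g.dist y'' y'))
        ≤ g.L ^ 2 * (Real.exp (-(δ₀ / 3 * g.dist y y'')) * Real.exp (-(δ₀ / 3 * g.dist y'' y'))) := by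
    intro y''
    have habs := ratio_mul_exp_le hL hβ hthr y y''
    have e1 : Real.exp (-(1 / 3 * δ₀ * g.dist y y'')) = Real.exp (-(δ₀ / 3 * g.dist y y'')) := by congr 1; ring
    have e2 : Real.exp (-(1 / 3 * δ₀ * g.dist y'' y')) = Real.exp (-(δ₀ / 3 * g.dist y'' y')) := by congr 1; ring
    rw [e1, e2]
    calc Real.exp (-(1 / 6 * δ₀ * g.R * g.M * mx g y y'')) * ratio g y y'' * Real.exp (-(δ₀ / 3 * g.dist y y'')) *
          Real.exp (-(δ₀ / 3 * g.dist y'' y'))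
        = (ratio g y y'' * Real.exp (-(1 / 6 * δ₀ * g.R * g.M * mx g y y''))) *
            (Real.exp (-(δ₀ / 3 * g.dist y y'')) * Real.exp (-(δ₀ / 3 * g.dist y'' y'))) := by ring
      _ ≤ g.L ^ 2 * (Real.exp (-(δ₀ / 3 * g.dist y y'')) * Real.exp (-(δ₀ / 3 * g.dist y'' y'))) := by
          gcongr
  have h2 := h263 1 y y'
  rw [chain_one] at h2
  have e3 : Real.exp (-((1 - 1 / 4) * (δ₀ / 3) * g.dist y y')) = line5 g δ₀ y y' := by
    unfold line5; congr 1; ring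
  rw [e3] at h2
  unfold line4
  calc ∑ y'' : g.Site, Real.exp (-(1 / 6 * δ₀ * g.R * g.M * mx g y y'')) * ratio g y y'' *
          Real.exp (-(1 / 3 * δ₀ * g.dist y y'')) * Real.exp (-(1 / 3 * δ₀ * g.dist y'' y'))
      ≤ ∑ y'' : g.Site, g.L ^ 2 * (Real.exp (-(δ₀ / 3 * g.dist y y'')) * Real.exp (-(δ₀ / 3 * g.dist y'' y'))) :=
        Finset.sum_le_sum fun y'' _ => hpt y''
    _ = g.L ^ 2 * ∑ y'' : g.Site, Real.exp (-(δ₀ / 3 * g.dist y y'')) * Real.exp (-(δ₀ / 3 * g.dist y'' y')) := by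
        rw [Finset.mul_sum]
    _ ≤ g.L ^ 2 * (c ^ (1 + 1) * line5 g δ₀ y y') := mul_le_mul_of_nonneg_left h2 (by positivity)
    _ = g.L ^ 2 * c ^ 2 * line5 g δ₀ y y' := by ring

end Engine

/-! ## §4. The threshold is attained: a chain witness satisfying every OTHER hypothesis uniformly in k -/

section Witness

/-- THE CHAIN WITNESS of depth k: one site per level, 𝔅 = {0, 1, …, k} with j(i) = i, d(i, i′) = RM·|i − i′| (every
pair of consecutive levels exactly RM apart — the extremal configuration (2.57)–(2.58) allow), spacing η = L^{−k}; the
localisation vocabulary of `B6.Geometry` (Props 2.2–2.8) is irrelevant here and filled trivially.  (Reducible, so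
that `(chainGeo k L R M).Site` is seen as `Fin (k + 1)` by coercions and numerals.) [folklore] -/
@[reducible] noncomputable def chainGeo (k : ℕ) (L R M : ℝ) : B6.Geometry where
  Site := Fin (k + 1)
  fin := inferInstance
  scale := fun i => (i : ℕ)
  dist := fun i i' => R * M * |((i : ℕ) : ℝ) - ((i' : ℕ) : ℝ)|
  k := k
  eta := (L ^ k)⁻¹
  L := L
  R := R
  M := M
  Hyp21_22 := True
  Loc := PUnit
  suppIn := fun _ _ => True
  supNorm := fun _ => 0
  l2Norm := fun _ => 0
  holder := fun _ _ => 0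
  Cut := PUnit
  cutIn := fun _ _ => True
  cutH := fun _ _ => 0
  cutSup := fun _ => 0

variable {k : ℕ} {L R M : ℝ}

/-- The witness distance, by definition. [folklore] -/
@[simp] theorem chainGeo_dist (i i' : Fin (k + 1)) :
    (chainGeo k L R M).dist i i' = R * M * |((i : ℕ) : ℝ) - ((i' : ℕ) : ℝ)| := rfl

/-- The witness scale map, by definition. [folklore] -/
@[simp] theorem chainGeo_scale (i : Fin (k + 1)) : (chainGeo k L R M).scale i = (i : ℕ) := rfl

/-- The witness parameter L, by definition. [folklore] -/
@[simp] theorem chainGeo_L : (chainGeo k L R M).L = L := rfl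

/-- The witness parameter R, by definition. [folklore] -/
@[simp] theorem chainGeo_R : (chainGeo k L R M).R = R := rfl

/-- The witness parameter M, by definition. [folklore] -/
@[simp] theorem chainGeo_M : (chainGeo k L R M).M = M := rfl

/-- The witness satisfies the triangle inequality (2.54). [folklore] -/
theorem chainGeo_triangle (hRM : 0 ≤ R * M) : B6RandomWalk.Triangle254 (chainGeo k L R M) := by
  intro a b c
  rw [chainGeo_dist, chainGeo_dist, chainGeo_dist, ← mul_add]
  exact mul_le_mul_of_nonneg_left (abs_sub_le _ _ _) hRM

/-- The witness has a symmetric distance. [folklore] -/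
theorem chainGeo_symm : Symm (chainGeo k L R M) := by
  intro a b
  rw [chainGeo_dist, chainGeo_dist, abs_sub_comm]

/-- The witness satisfies the metric form of (2.60) (hence (2.60) at every rate, `ineq260_of_levelSep`). [folklore] -/
theorem chainGeo_levelSep (hRM : 0 ≤ R * M) : LevelSep (chainGeo k L R M) := by
  intro a b
  rw [chainGeo_dist]
  simp only [mx]
  refine mul_le_mul_of_nonneg_left (max_le ?_ (abs_nonneg _)) hRM
  linarith [abs_nonneg (((a : ℕ) : ℝ) - ((b : ℕ) : ℝ))]

/-- The witness satisfies (2.61) at every rate α with the k-INDEPENDENT constant c₀ of p. 233 evaluated at the rate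
αδ₀RM: Σ_{i′} e^{−αδ₀RM|i−i′|} ≤ Σ_{z∈ℤ} e^{−αδ₀RM|z|} = `B6.c0 (δ₀RM) α`. [folklore] -/
theorem chainGeo_ineq261With {δ₀ α : ℝ} (h : 0 < α * (δ₀ * (R * M))) :
    B6Lemma21Repaired.Ineq261With (B6.c0 (δ₀ * (R * M)) α) (chainGeo k L R M) δ₀ α := by
  intro i
  unfold B6.c0
  set f : ℤ → ℝ := fun z => Real.exp (-(α * (δ₀ * (R * M)) * |(z : ℝ)|)) with hf
  have hsum : Summable f := B6Lemma21Arith.summable_c0_term h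
  let φ : Fin (k + 1) → ℤ := fun i' => ((i' : ℕ) : ℤ) - ((i : ℕ) : ℤ)
  have hinj : Function.Injective φ := by
    intro a b hab
    have h' : ((a : ℕ) : ℤ) - ((i : ℕ) : ℤ) = ((b : ℕ) : ℤ) - ((i : ℕ) : ℤ) := hab
    exact Fin.ext (by omega)
  have hterm : ∀ i' : Fin (k + 1),
      Real.exp (-(α * δ₀ * (chainGeo k L R M).dist i i')) = f (φ i') := by
    intro i'
    simp only [hf, φ]
    push_cast
    rw [abs_sub_comm]
    congr 1
    ring
  calc ∑ i', Real.exp (-(α * δ₀ * (chainGeo k L R M).dist i i'))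
      = ∑ i', f (φ i') := Finset.sum_congr rfl fun i' _ => hterm i'
    _ = ∑ z ∈ Finset.univ.image φ, f z := (Finset.sum_image fun a _ b _ hab => hinj hab).symm
    _ ≤ ∑' z, f z := hsum.sum_le_tsum _ fun z _ => (Real.exp_pos _).le

/-- The diagonal term y″ = y′ of line 4 in the witness of depth N ≥ 1, between the bottom level y = 0 and the top
level y′ = N: e^{−⅙δ₀RM(N−1)} · L^{2N} · e^{−⅓δ₀RM·N} · 1. [folklore] -/
theorem chainGeo_diag_term (N : ℕ) (hN : 1 ≤ N) (δ₀ : ℝ) :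
    Real.exp (-(1 / 6 * δ₀ * (chainGeo N L R M).R * (chainGeo N L R M).M *
        mx (chainGeo N L R M) (0 : Fin (N + 1)) (Fin.last N))) * ratio (chainGeo N L R M) (0 : Fin (N + 1)) (Fin.last N) *
      Real.exp (-(1 / 3 * δ₀ * (chainGeo N L R M).dist (0 : Fin (N + 1)) (Fin.last N))) *
      Real.exp (-(1 / 3 * δ₀ * (chainGeo N L R M).dist (Fin.last N) (Fin.last N)))
    = Real.exp (-(1 / 6 * δ₀ * R * M * ((N : ℝ) - 1))) * L ^ (2 * N) * Real.exp (-(1 / 3 * δ₀ * R * M * N)) := by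
  obtain ⟨n, rfl⟩ : ∃ n, N = n + 1 := ⟨N - 1, by omega⟩
  have hmx : mx (chainGeo (n + 1) L R M) (0 : Fin (n + 1 + 1)) (Fin.last (n + 1)) = n :=
    mx_eq_of_lt (g := chainGeo (n + 1) L R M) (by simp; omega)
  rw [hmx]
  simp only [ratio, Fin.val_zero, Fin.val_last, sub_self, abs_zero, mul_zero, neg_zero, Real.exp_zero, mul_one,
    pow_zero, div_one]
  push_cast
  rw [zero_sub, abs_neg, abs_of_nonneg (by positivity)]
  ring_nf

/-- **THE THRESHOLD IS SHARP.**  If L² > e^{¼δ₀RM} (i.e. 8 log L > δ₀RM), then for every constant C there is a depth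
N and a pair of sites of the chain witness — which satisfies (2.54), symmetry, (2.60) and (2.61) with k-independent
constants (`chainGeo_triangle`, `chainGeo_symm`, `chainGeo_levelSep`, `chainGeo_ineq261With`) — at which
line 4 > C · line 5: no O(1) independent of the number of scales exists in (2.68) line 5 beyond the threshold of
`line4_le_line5`.  (The violating term is the diagonal one, y″ = y′ at the top level: L^{2N}e^{−½δ₀RMN} against
e^{−¼δ₀RMN}.) [folklore] -/
theorem line4_not_uniform {δ₀ : ℝ} (hL : 1 ≤ L) (hδRM : 0 ≤ δ₀ * (R * M)) (hthr : Real.exp (1 / 4 * δ₀ * R * M) < L ^ 2)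
    (C : ℝ) :
    ∃ N : ℕ, C * line5 (chainGeo N L R M) δ₀ (0 : Fin (N + 1)) (Fin.last N) <
      line4 (chainGeo N L R M) δ₀ (0 : Fin (N + 1)) (Fin.last N) := by
  -- the ratio r = L² e^{−¼δ₀RM} > 1
  set r : ℝ := L ^ 2 * Real.exp (-(1 / 4 * δ₀ * R * M)) with hr
  have hr1 : 1 < r := by
    rw [hr, Real.exp_neg, ← div_eq_mul_inv, one_lt_div (Real.exp_pos _)]
    exact hthr
  obtain ⟨n, hn⟩ := pow_unbounded_of_one_lt C hr1
  refine ⟨n + 1, ?_⟩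
  have hL0 : 0 < L := lt_of_lt_of_le one_pos hL
  -- line 4 ≥ its diagonal term
  have hdiag := chainGeo_diag_term (L := L) (R := R) (M := M) (n + 1) (by omega) δ₀
  have hge : Real.exp (-(1 / 6 * δ₀ * R * M * (((n + 1 : ℕ) : ℝ) - 1))) * L ^ (2 * (n + 1)) *
        Real.exp (-(1 / 3 * δ₀ * R * M * ((n + 1 : ℕ) : ℝ)))
      ≤ line4 (chainGeo (n + 1) L R M) δ₀ (0 : Fin (n + 1 + 1)) (Fin.last (n + 1)) := by
    rw [← hdiag]
    unfold line4
    exact Finset.single_le_sum (f := fun y'' => Real.exp (-(1 / 6 * δ₀ * (chainGeo (n + 1) L R M).R *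
        (chainGeo (n + 1) L R M).M * mx (chainGeo (n + 1) L R M) (0 : Fin (n + 1 + 1)) y'')) *
        ratio (chainGeo (n + 1) L R M) (0 : Fin (n + 1 + 1)) y'' *
        Real.exp (-(1 / 3 * δ₀ * (chainGeo (n + 1) L R M).dist (0 : Fin (n + 1 + 1)) y'')) *
        Real.exp (-(1 / 3 * δ₀ * (chainGeo (n + 1) L R M).dist y'' (Fin.last (n + 1)))))
      (fun y'' _ => by
        have := ratio_nonneg (g := chainGeo (n + 1) L R M) (by simpa using hL0.le) 0 y''
        positivity)
      (Finset.mem_univ _)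
  -- line 5 at (0, N)
  have h5 : line5 (chainGeo (n + 1) L R M) δ₀ (0 : Fin (n + 1 + 1)) (Fin.last (n + 1)) =
      Real.exp (-(1 / 4 * δ₀ * R * M * ((n + 1 : ℕ) : ℝ))) := by
    unfold line5
    simp only [Fin.val_zero, Fin.val_last, CharP.cast_eq_zero, zero_sub, abs_neg]
    rw [abs_of_nonneg (by positivity)]
    congr 1; ring
  rw [h5]
  refine lt_of_lt_of_le ?_ hge
  -- algebra: the diagonal term = e^{⅙δ₀RM} · r^N · e^{−¼δ₀RMN}
  have hN : (((n + 1 : ℕ) : ℝ) - 1) = (n : ℝ) := by push_cast; ring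
  rw [hN]
  have hkey : Real.exp (-(1 / 6 * δ₀ * R * M * (n : ℝ))) * L ^ (2 * (n + 1)) *
        Real.exp (-(1 / 3 * δ₀ * R * M * ((n + 1 : ℕ) : ℝ)))
      = Real.exp (1 / 6 * δ₀ * R * M) * r ^ (n + 1) * Real.exp (-(1 / 4 * δ₀ * R * M * ((n + 1 : ℕ) : ℝ))) := by
    rw [hr, mul_pow, ← pow_mul, ← Real.exp_nat_mul]
    have e1 : ∀ a b : ℝ, Real.exp a * L ^ (2 * (n + 1)) * Real.exp b = L ^ (2 * (n + 1)) * Real.exp (a + b) := by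
      intro a b; rw [Real.exp_add]; ring
    have e2 : ∀ a b c : ℝ, Real.exp a * (L ^ (2 * (n + 1)) * Real.exp b) * Real.exp c =
        L ^ (2 * (n + 1)) * Real.exp (a + b + c) := by
      intro a b c; rw [Real.exp_add, Real.exp_add]; ring
    rw [e1, e2]
    congr 1
    congr 1
    push_cast
    ring
  rw [hkey]
  have hexp1 : 1 ≤ Real.exp (1 / 6 * δ₀ * R * M) := by
    rw [Real.one_le_exp_iff]; nlinarith [mul_assoc δ₀ R M]
  have hrpos : 0 < r ^ (n + 1) := pow_pos (lt_trans one_pos hr1) _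
  have hrn : C < r ^ (n + 1) := lt_of_lt_of_le hn (pow_le_pow_right₀ hr1.le (by omega))
  have h5pos : 0 < Real.exp (-(1 / 4 * δ₀ * R * M * ((n + 1 : ℕ) : ℝ))) := Real.exp_pos _
  have : C < Real.exp (1 / 6 * δ₀ * R * M) * r ^ (n + 1) := by nlinarith
  exact mul_lt_mul_of_pos_right this h5pos

/-- The diagonal term y″ = y′ of line 2 of (2.68) on the chain witness, y = level 0, y′ = level N:
L^{2N} e^{−½δ₀RMN}. [folklore] -/
theorem chainGeo_diag_term2 (N : ℕ) (δ₀ : ℝ) :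
    ratio (chainGeo N L R M) (0 : Fin (N + 1)) (Fin.last N) *
        Real.exp (-(1 / 2 * δ₀ * (chainGeo N L R M).dist (0 : Fin (N + 1)) (Fin.last N))) *
      Real.exp (-(1 / 2 * δ₀ * (chainGeo N L R M).dist (Fin.last N) (Fin.last N)))
    = L ^ (2 * N) * Real.exp (-(1 / 2 * δ₀ * R * M * N)) := by
  simp only [ratio, Fin.val_zero, Fin.val_last, sub_self, abs_zero, mul_zero, neg_zero, Real.exp_zero, mul_one,
    pow_zero, div_one]
  push_cast
  rw [zero_sub, abs_neg, abs_of_nonneg (by positivity)]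
  ring_nf

/-- The same threshold governs line 2 of (2.68) (before the printed splitting of the rates): if L² > e^{¼δ₀RM}
then for every C some depth N and pair of sites of the chain witness give line 2 > C · line 5 — so NO route from
line 2 to line 5 using only (2.54), symmetry, (2.60), (2.61) has an O(1) independent of the number of scales beyond
8 log L ≤ δ₀RM (cf. `line2_le_line5`, which attains it). [folklore] -/
theorem line2_not_uniform {δ₀ : ℝ} (hL : 1 ≤ L) (hthr : Real.exp (1 / 4 * δ₀ * R * M) < L ^ 2) (C : ℝ) :
    ∃ N : ℕ, C * line5 (chainGeo N L R M) δ₀ (0 : Fin (N + 1)) (Fin.last N) <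
      line2 (chainGeo N L R M) δ₀ (0 : Fin (N + 1)) (Fin.last N) := by
  set r : ℝ := L ^ 2 * Real.exp (-(1 / 4 * δ₀ * R * M)) with hr
  have hr1 : 1 < r := by
    rw [hr, Real.exp_neg, ← div_eq_mul_inv, one_lt_div (Real.exp_pos _)]
    exact hthr
  obtain ⟨n, hn⟩ := pow_unbounded_of_one_lt C hr1
  refine ⟨n, ?_⟩
  have hL0 : 0 < L := lt_of_lt_of_le one_pos hL
  have hdiag := chainGeo_diag_term2 (L := L) (R := R) (M := M) n δ₀
  have hge : L ^ (2 * n) * Real.exp (-(1 / 2 * δ₀ * R * M * n))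
      ≤ line2 (chainGeo n L R M) δ₀ (0 : Fin (n + 1)) (Fin.last n) := by
    rw [← hdiag]
    unfold line2
    exact Finset.single_le_sum (f := fun y'' => ratio (chainGeo n L R M) (0 : Fin (n + 1)) y'' *
        Real.exp (-(1 / 2 * δ₀ * (chainGeo n L R M).dist (0 : Fin (n + 1)) y'')) *
        Real.exp (-(1 / 2 * δ₀ * (chainGeo n L R M).dist y'' (Fin.last n))))
      (fun y'' _ => by
        have := ratio_nonneg (g := chainGeo n L R M) (by simpa using hL0.le) 0 y''
        positivity)
      (Finset.mem_univ _)
  have h5 : line5 (chainGeo n L R M) δ₀ (0 : Fin (n + 1)) (Fin.last n) =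
      Real.exp (-(1 / 4 * δ₀ * R * M * (n : ℝ))) := by
    unfold line5
    simp only [Fin.val_zero, Fin.val_last, CharP.cast_eq_zero, zero_sub, abs_neg]
    rw [abs_of_nonneg (by positivity)]
    congr 1; ring
  rw [h5]
  refine lt_of_lt_of_le ?_ hge
  have hkey : L ^ (2 * n) * Real.exp (-(1 / 2 * δ₀ * R * M * n)) =
      r ^ n * Real.exp (-(1 / 4 * δ₀ * R * M * (n : ℝ))) := by
    rw [hr, mul_pow, ← pow_mul, ← Real.exp_nat_mul, mul_assoc (L ^ (2 * n)), ← Real.exp_add]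
    congr 1
    congr 1
    ring
  rw [hkey]
  exact mul_lt_mul_of_pos_right hn (Real.exp_pos _)

end Witness

/-! ## §5. The «purely conventional» choice of powers: the swap and its cost -/

section Swap

variable {g : B6.Geometry}

/-- **THE POWER SWAP, WITH ITS COST.**  p. 235, verbatim: *"Let us notice that the choice of powers (L^jη)⁴ and
(L^{j′}η)^{−d} in the inequality above is purely conventional and we may change it into any other admissible choice, for
example (L^jη)^{−d} and (L^{j′}η)⁴, using the exponential factor e^{−¼δ₀d(y,y′)} and the estimate (2.60)."*  Certified in
the quantitative form the sentence does not print: the swap costs the factor L^{d+4} and an arbitrary fraction ε of the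
decay rate, and needs (d+4) log L ≤ εδ₀RM (typed: L^{d+4} ≤ e^{εδ₀RM}) — the scale mismatch (L^jη/L^{j′}η)^{d+4} =
L^{(d+4)(j−j′)} is absorbed, one level for free and the others through (2.60), by e^{εδ₀d(y,y′)}. Hypotheses: the metric
form of (2.60), RM ≥ 0, L ≥ 1, η > 0, εδ₀ ≥ 0. [cite: Balaban1984PropagatorsII, p.235 (sentence after (2.68))] -/
theorem power_swap (d : ℕ) (hsep : LevelSep g) (hRM : 0 ≤ g.R * g.M) (hL : 1 ≤ g.L) (hη : 0 < g.eta) {ε δ₀ : ℝ}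
    (hεδ : 0 ≤ ε * δ₀) (hthr : g.L ^ (d + 4) ≤ Real.exp (ε * δ₀ * g.R * g.M)) (y y' : g.Site) :
    Real.exp (-(1 / 4 * δ₀ * g.dist y y')) * (g.len y ^ 4 / g.len y' ^ d) ≤
      g.L ^ (d + 4) * Real.exp (-((1 / 4 - ε) * δ₀ * g.dist y y')) * (g.len y' ^ 4 / g.len y ^ d) := by
  have hL0 : 0 < g.L := lt_of_lt_of_le one_pos hL
  have hlen : ∀ z : g.Site, 0 < g.len z := fun z => by unfold B6.Geometry.len; positivity
  have hd0 : 0 ≤ g.dist y y' := dist_nonneg_of_levelSep hsep hRM y y'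
  -- the main inequality between the (d+4)-th powers of the two lengths
  have hmain : g.len y ^ (d + 4) ≤ g.L ^ (d + 4) * Real.exp (ε * δ₀ * g.dist y y') * g.len y' ^ (d + 4) := by
    rcases le_or_gt (g.scale y) (g.scale y') with hle | hlt
    · -- j ≤ j′: len y ≤ len y′ and both extra factors are ≥ 1
      have hyy : g.len y ≤ g.len y' := by
        unfold B6.Geometry.len
        exact mul_le_mul_of_nonneg_right (pow_le_pow_right₀ hL hle) hη.le
      have h1 : 1 ≤ g.L ^ (d + 4) * Real.exp (ε * δ₀ * g.dist y y') := by
        have ha : 1 ≤ g.L ^ (d + 4) := one_le_pow₀ hL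
        have hb : 1 ≤ Real.exp (ε * δ₀ * g.dist y y') := by
          rw [Real.one_le_exp_iff]; exact mul_nonneg hεδ hd0
        nlinarith
      calc g.len y ^ (d + 4) ≤ g.len y' ^ (d + 4) := pow_le_pow_left₀ (hlen y).le hyy _
        _ = 1 * g.len y' ^ (d + 4) := (one_mul _).symm
        _ ≤ g.L ^ (d + 4) * Real.exp (ε * δ₀ * g.dist y y') * g.len y' ^ (d + 4) :=
            mul_le_mul_of_nonneg_right h1 (pow_nonneg (hlen y').le _)
    · -- j = j′ + 1 + n: len y = L^{n+1} len y′, and (L^{d+4})ⁿ ≤ e^{εδ₀RMn} ≤ e^{εδ₀d(y,y′)}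
      obtain ⟨n, hn⟩ := Nat.exists_eq_add_of_lt hlt
      have hn' : g.scale y = g.scale y' + 1 + n := by omega
      have hmx : mx g y y' = n := mx_eq_of_lt' hn'
      have hleny : g.len y = g.L ^ (n + 1) * g.len y' := by
        unfold B6.Geometry.len; rw [hn']; ring
      have hpow : (g.L ^ (d + 4)) ^ n ≤ Real.exp (ε * δ₀ * g.dist y y') := by
        calc (g.L ^ (d + 4)) ^ n ≤ Real.exp (ε * δ₀ * g.R * g.M) ^ n := pow_le_pow_left₀ (by positivity) hthr n
          _ = Real.exp (ε * δ₀ * g.R * g.M * n) := by rw [← Real.exp_nat_mul]; congr 1; ring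
          _ ≤ Real.exp (ε * δ₀ * g.dist y y') := by
              rw [Real.exp_le_exp]
              have h1 := hsep y y'
              rw [hmx] at h1
              nlinarith
      calc g.len y ^ (d + 4) = g.L ^ (d + 4) * (g.L ^ (d + 4)) ^ n * g.len y' ^ (d + 4) := by
            rw [hleny]; ring
        _ ≤ g.L ^ (d + 4) * Real.exp (ε * δ₀ * g.dist y y') * g.len y' ^ (d + 4) :=
            mul_le_mul_of_nonneg_right (mul_le_mul_of_nonneg_left hpow (by positivity))
              (pow_nonneg (hlen y').le _)
  -- convert to the displayed form
  have hA := hlen y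
  have hB := hlen y'
  have hexp : Real.exp (-((1 / 4 - ε) * δ₀ * g.dist y y')) =
      Real.exp (-(1 / 4 * δ₀ * g.dist y y')) * Real.exp (ε * δ₀ * g.dist y y') := by
    rw [← Real.exp_add]; congr 1; ring
  have hAd : 0 < g.len y ^ d := pow_pos hA d
  have hBd : 0 < g.len y' ^ d := pow_pos hB d
  rw [hexp, ← mul_div_assoc, ← mul_div_assoc, div_le_div_iff₀ hBd hAd]
  calc Real.exp (-(1 / 4 * δ₀ * g.dist y y')) * g.len y ^ 4 * g.len y ^ d
      = Real.exp (-(1 / 4 * δ₀ * g.dist y y')) * g.len y ^ (d + 4) := by ring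
    _ ≤ Real.exp (-(1 / 4 * δ₀ * g.dist y y')) *
          (g.L ^ (d + 4) * Real.exp (ε * δ₀ * g.dist y y') * g.len y' ^ (d + 4)) :=
        mul_le_mul_of_nonneg_left hmain (Real.exp_pos _).le
    _ = g.L ^ (d + 4) * (Real.exp (-(1 / 4 * δ₀ * g.dist y y')) * Real.exp (ε * δ₀ * g.dist y y')) *
          g.len y' ^ 4 * g.len y' ^ d := by ring

/-- For the operator the sentence is about, the swap is FREE: a kernel symmetric in the (2.69) convention
(Q′G′²Q′* is self-adjoint there — *"positive definite"*, p. 235; `applyW_selfAdjoint_iff`) over a symmetric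
distance satisfies the swapped orientation of (2.68) with the SAME constant and the SAME rate ¼δ₀, with no condition
on L: |k(y,y′)| = |k(y′,y)| ≤ C(L^{j′}η)⁴(L^{j}η)^{−d}e^{−¼δ₀d(y′,y)}.  The cost computed in `power_swap` is incurred
only by NON-symmetric kernels obeying a one-sided bound of the form (2.68). [folklore] -/
theorem swap_of_symm (d : ℕ) (hsymm : Symm g) {δ₀ C : ℝ} (k : g.Site → g.Site → ℝ) (hk : ∀ y y', k y y' = k y' y)
    (h268 : ∀ y y', |k y y'| ≤ C * (g.len y ^ 4 / g.len y' ^ d) * Real.exp (-(1 / 4 * δ₀ * g.dist y y')))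
    (y y' : g.Site) :
    |k y y'| ≤ C * (g.len y' ^ 4 / g.len y ^ d) * Real.exp (-(1 / 4 * δ₀ * g.dist y y')) := by
  rw [hk, hsymm]
  exact h268 y' y

end Swap

/-! ## §6. Boundedness on L²(𝔅) from (2.61) alone: the symmetric weighted Schur test -/

section Schur

variable {S : Type} [Fintype S]

/-- The operator with (2.69)-KERNEL k: (K λ)(y) = Σ_{y′∈𝔅} w(y′) k(y, y′) λ(y′), w(y′) = (L^{j′}η)^d — the convention in
which B6 writes kernels on 𝔅 ((2.68) line 1, (2.83): *"Σ_{y″} (L^{j′}η)^d (Q′G′²Q′*)(y, y″) …"*; cf. `B6WeightedEncoding`).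
[cite: Balaban1984PropagatorsII, (2.69) p.235 + (2.83) p.237] -/
def applyW (w : S → ℝ) (k : S → S → ℝ) (v : S → ℝ) (y : S) : ℝ := ∑ y' : S, w y' * k y y' * v y'

/-- In the weighted product ⟨λ, λ′⟩ = Σ w λ λ′ of (2.69), K is self-adjoint iff its (2.69)-kernel is symmetric
(w > 0).  (So the printed sentence *"Of course the operator Q′G′²Q′* is positive definite, so its inverse is well
defined."* (p. 235) — positive definite, in particular self-adjoint, Q′G′²Q′* = (G′Q′*)*(G′Q′*) — delivers the symmetry
used below.) [folklore] -/
theorem applyW_selfAdjoint_iff [DecidableEq S] (w : S → ℝ) (hw : ∀ y, 0 < w y) (k : S → S → ℝ) :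
    (∀ u v : S → ℝ, ∑ y, w y * u y * applyW w k v y = ∑ y, w y * applyW w k u y * v y) ↔
      ∀ y y', k y y' = k y' y := by
  constructor
  · intro h a b
    have hab := h (fun y => if y = a then 1 else 0) (fun y => if y = b then 1 else 0)
    simp only [applyW, mul_ite, mul_one, mul_zero, Finset.sum_ite_eq', Finset.mem_univ, if_true, ite_mul,
      zero_mul] at hab
    have hwa := hw a
    have hwb := hw b
    have : w a * (w b * k a b) = w b * (w a * k b a) := by simpa using hab
    have hw0 : w a * w b ≠ 0 := by positivity
    have := mul_left_cancel₀ hw0 (by linear_combination this : w a * w b * k a b = w a * w b * k b a)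
    exact this
  · intro hk u v
    simp only [applyW, Finset.mul_sum, Finset.sum_mul]
    rw [Finset.sum_comm]
    refine Finset.sum_congr rfl fun y _ => Finset.sum_congr rfl fun y' _ => ?_
    rw [hk y' y]; ring

/-- **WEIGHTED SCHUR TEST.**  If w ≥ 0, every weighted row sum Σ_{y′} w(y′)|k(y,y′)| ≤ R and every weighted column
sum Σ_y w(y)|k(y,y′)| ≤ C, then ‖Kλ‖²_w ≤ RC‖λ‖²_w (from the tree's row-wise Cauchy–Schwarz `SchurTest.row_sq_le`).
[folklore] -/
theorem weighted_schur (w : S → ℝ) (hw : ∀ y, 0 ≤ w y) (k : S → S → ℝ) {R C : ℝ}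
    (hR : ∀ y, ∑ y', w y' * |k y y'| ≤ R) (hC : ∀ y', ∑ y, w y * |k y y'| ≤ C) (v : S → ℝ) :
    ∑ y, w y * applyW w k v y ^ 2 ≤ R * C * ∑ y, w y * v y ^ 2 := by
  rcases isEmpty_or_nonempty S with hS | ⟨⟨y₀⟩⟩
  · simp
  have hR0 : 0 ≤ R := le_trans (Finset.sum_nonneg fun y' _ => mul_nonneg (hw y') (abs_nonneg _)) (hR y₀)
  have habs : ∀ y y', |w y' * k y y'| = w y' * |k y y'| := fun y y' => by
    rw [abs_mul, abs_of_nonneg (hw y')]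
  have hrow : ∀ y, applyW w k v y ^ 2 ≤ R * ∑ y', w y' * |k y y'| * v y' ^ 2 := by
    intro y
    have h := SchurTest.row_sq_le (fun a b => w b * k a b) v y
    simp only [habs] at h
    unfold applyW
    calc (∑ y', w y' * k y y' * v y') ^ 2 ≤ (∑ y', w y' * |k y y'|) * ∑ y', w y' * |k y y'| * v y' ^ 2 := h
      _ ≤ R * ∑ y', w y' * |k y y'| * v y' ^ 2 :=
          mul_le_mul_of_nonneg_right (hR y) (Finset.sum_nonneg fun y' _ => by
            have := hw y'; positivity)
  calc ∑ y, w y * applyW w k v y ^ 2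
      ≤ ∑ y, w y * (R * ∑ y', w y' * |k y y'| * v y' ^ 2) :=
        Finset.sum_le_sum fun y _ => mul_le_mul_of_nonneg_left (hrow y) (hw y)
    _ = R * ∑ y', w y' * v y' ^ 2 * ∑ y, w y * |k y y'| := by
        rw [Finset.mul_sum]
        simp_rw [Finset.mul_sum]
        rw [Finset.sum_comm]
        refine Finset.sum_congr rfl fun y' _ => Finset.sum_congr rfl fun y _ => ?_
        ring
    _ ≤ R * ∑ y', w y' * v y' ^ 2 * C := by
        refine mul_le_mul_of_nonneg_left (Finset.sum_le_sum fun y' _ => ?_) hR0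
        exact mul_le_mul_of_nonneg_left (hC y') (mul_nonneg (hw y') (sq_nonneg _))
    _ = R * C * ∑ y, w y * v y ^ 2 := by rw [← Finset.sum_mul]; ring

/-- The symmetric case: a symmetric kernel needs its weighted ROW sums only (columns = rows). [folklore] -/
theorem weighted_schur_symm (w : S → ℝ) (hw : ∀ y, 0 ≤ w y) (k : S → S → ℝ) (hk : ∀ y y', k y y' = k y' y)
    {R : ℝ} (hR : ∀ y, ∑ y', w y' * |k y y'| ≤ R) (v : S → ℝ) :
    ∑ y, w y * applyW w k v y ^ 2 ≤ R ^ 2 * ∑ y, w y * v y ^ 2 := by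
  have hC : ∀ y', ∑ y, w y * |k y y'| ≤ R := fun y' => by
    simpa only [hk _ y'] using hR y'
  simpa [sq] using weighted_schur w hw k hR hC v

variable {g : B6.Geometry}

/-- **Q′G′²Q′* IS BOUNDED ON L²(𝔅) FROM (2.61) ALONE.**  p. 235: *"It is easy to see from the bound (2.58) that Q′G′²Q′*
is a bounded operator on this space; we have to use only the bound (2.61)."*  Certified: a kernel k on 𝔅 that is
symmetric in the (2.69) convention (self-adjointness, `applyW_selfAdjoint_iff`) and obeys (2.68),
|k(y,y′)| ≤ C(L^jη)⁴(L^{j′}η)^{−d}e^{−¼δ₀d(y,y′)}, has weighted row sums ≤ C·c by (2.61) at α = ¼ (the weight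
(L^{j′}η)^d cancels the factor (L^{j′}η)^{−d} exactly, and (L^jη)⁴ ≤ 1), hence ‖Q′G′²Q′*‖_{L²(𝔅)} ≤ C·c₁(¼) by the
symmetric weighted Schur test — with NO interchange of the powers and NO condition on log L.  Hypotheses: 0 < L^jη ≤ 1
for every site (scales j ≤ k, η = L^{−k}), C ≥ 0. [cite: Balaban1984PropagatorsII, p.235 (the L²(𝔅) sentence after (2.69))] -/
theorem bounded_of_ineq268 (d : ℕ) {δ₀ C c : ℝ} (hC : 0 ≤ C) (hlen : ∀ y : g.Site, 0 < g.len y ∧ g.len y ≤ 1)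
    (k : g.Site → g.Site → ℝ) (hk : ∀ y y', k y y' = k y' y)
    (h268 : ∀ y y', |k y y'| ≤ C * (g.len y ^ 4 / g.len y' ^ d) * Real.exp (-(1 / 4 * δ₀ * g.dist y y')))
    (h261 : B6Lemma21Repaired.Ineq261With c g δ₀ (1 / 4)) (v : g.Site → ℝ) :
    ∑ y, g.len y ^ d * applyW (fun y => g.len y ^ d) k v y ^ 2 ≤ (C * c) ^ 2 * ∑ y, g.len y ^ d * v y ^ 2 := by
  refine weighted_schur_symm (fun y => g.len y ^ d) (fun y => pow_nonneg (hlen y).1.le d) k hk ?_ v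
  intro y
  have hy := hlen y
  have hrow : ∀ y', g.len y' ^ d * |k y y'| ≤ C * g.len y ^ 4 * Real.exp (-(1 / 4 * δ₀ * g.dist y y')) := by
    intro y'
    have hy' := hlen y'
    have hBd : 0 < g.len y' ^ d := pow_pos hy'.1 d
    calc g.len y' ^ d * |k y y'| ≤ g.len y' ^ d * (C * (g.len y ^ 4 / g.len y' ^ d) *
          Real.exp (-(1 / 4 * δ₀ * g.dist y y'))) := mul_le_mul_of_nonneg_left (h268 y y') hBd.le
      _ = C * g.len y ^ 4 * Real.exp (-(1 / 4 * δ₀ * g.dist y y')) := by field_simp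
  have h4 : g.len y ^ 4 ≤ 1 := pow_le_one₀ hy.1.le hy.2
  have hs : 0 ≤ ∑ y', Real.exp (-(1 / 4 * δ₀ * g.dist y y')) := Finset.sum_nonneg fun _ _ => (Real.exp_pos _).le
  calc ∑ y', g.len y' ^ d * |k y y'| ≤ ∑ y', C * g.len y ^ 4 * Real.exp (-(1 / 4 * δ₀ * g.dist y y')) :=
        Finset.sum_le_sum fun y' _ => hrow y'
    _ = C * g.len y ^ 4 * ∑ y', Real.exp (-(1 / 4 * δ₀ * g.dist y y')) := by rw [Finset.mul_sum]
    _ ≤ C * 1 * ∑ y', Real.exp (-(1 / 4 * δ₀ * g.dist y y')) := by gcongr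
    _ ≤ C * 1 * c := mul_le_mul_of_nonneg_left (h261 y) (by positivity)
    _ = C * c := by ring

end Schur


end Literature.MathematicalPhysics.QuantumFieldTheory.Balaban1983to89.B6Ineq268
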